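/-
Copyright (c) 2026 the pub-hodgecm-mathlib formalisation cell (harness21).  Prover seat hodgecm-mathlib-K2Liu-p01 (g7), Track B «K2-LIT»,
#184♮ = hLiu418 = `stmt-HodgeConjecture-24832`; LEAD F0P6-plan (g14) BATCH #2 10:50:47Z «(S4-nat) `K2LiuLocalSWImageFrameNaturality`»; my census 11:01:35Z, brick (nat-R):
the ONE rigidity-transport head shared with K2Liu-p07 (g3)'s F5′-B (rational similitude) and my (S4-nat) (v-adic frame congruence).
-/
import Literature.NumberTheory.GelbartRogawski1991.LocalKudlaSplittingRigidity   -- ★ `eq_of_parabolic_toRep_conj_eq` (the model instance), `MpPsi.conj_ofScalar_mul`; brings `MpPsi.exists_character_of_proj_eq`, `toRep_ofScalar_mul`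
import HarnessLib

/-!
# Crux `HLiu418`, #42S organ S4, brick (nat-R): KUDLA RIGIDITY TRANSPORT — in ONE metaplectic model, a normalised section conjugated along `(ψ, P̃)` IS the transported
# normalised section, and the Siegel–Weil functionals agree up to a unit

Cell `hodgecm-mathlib`, crux item hLiu418 = `stmt-HodgeConjecture-24832` (helper lane `--supports … --as helper`, count-neutral).  THEOREMS ONLY (no `def`, no instance, no notation,
no named-fact hypothesis, no `sorry`).  FULLY ABSTRACT (any groups `G′`, `G″`, any model `ρ` of a Heisenberg group with implementers unique up to scalars, any `k`-linear probe
`ev` — the consumers take `ρ = localSchrodinger`, `ev = ` evaluation at `0`, `G′ = U(J′)(F_v)`, `G″ = U(J″)(F_v)`): the common kernel of ★ P3c `localSplittingDatumCM_localCongr_kd_eq_scaleTransportSection`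
(rational similitude `KD`), K2Liu-p07 (g3)'s F5′-B `K2LiuLocalSWSimilitudeRigidity` (`Ad(d_a)`), and (S4-nat) (the `v`-adic frame congruence `ψ_T`, `P = Res(1⊗T)∘k_S⁻¹`).

THE ARGUMENT ([Kudla1994, §3 Thm. 3.1]; [GelbartRogawski1991, §3.1 Remark p. 457]; [MoeglinVignerasWaldspurger1987, Chap. 2 II.1 (B)]).  In `S̃p_ψ = MpPsi ρ`:
a section `Σ : G′ →* S̃p_ψ` NORMALISED on a «parabolic» predicate `P′_Δ ⊆ G′` — `ev(ω(m Σ(p) m⁻¹)Φ) = c′(p)·ev(Φ)` for a fixed `m ∈ S̃p_ψ` — an isomorphism `ψ : G″ ≃* G′` matching predicates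
(`P′_Δ(ψ g) ↔ P″_Δ(g)`) and scalars (`c′(ψ p) = c″(p)`), ANY `P̃ ∈ S̃p_ψ`, and a section `Σ♯ : G″ →* S̃p_ψ` with the conjugate projection `π(Σ♯ g) = π(P̃)⁻¹ π(Σ(ψ g)) π(P̃)` normalised
for the mover `m·P̃` with `c″`.  Then `S(g) := P̃⁻¹ Σ(ψ g) P̃` is a homomorphism with `π ∘ S = π ∘ Σ♯`, and `(mP̃) S(p) (mP̃)⁻¹ = m Σ(ψ p) m⁻¹` shows `S` is normalised for `m·P̃` with
`c′ ∘ ψ = c″`; two sections over the same projection differ by a character `η` (★ `MpPsi.exists_character_of_proj_eq`), `η = 1` on `P″_Δ` by the two normalisations at a test vector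
with `ev ≠ 0`, hence `η = 1` if every character of `G″` trivial on `P″_Δ` is trivial: **`P̃⁻¹ · Σ(ψ g) · P̃ = Σ♯(g)`**.  SIEGEL–WEIL FUNCTIONALS: for movers `m₀′` and `m♯` with
`ev ∘ ω(m₀′ P̃ m♯⁻¹) = c_q · ev` (two movers of `ℓ_Δ` onto `ℓ_Y` differ by a `P_Y`-element, whose operator fixes `ev₀` up to a unit):
**`ev(ω(m₀′ Σ(ψ g))Φ) = c_q · ev(ω(m♯ Σ♯(g))(ω(P̃)⁻¹Φ))`** — the local Siegel–Weil section of `Φ` read through `ψ` is `c_q` times that of `ω(P̃)⁻¹Φ`, so the IMAGES coincide.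
* §1 `eq_of_normalised_of_proj_eq` — ★ `eq_of_parabolic_toRep_conj_eq` with the group, the predicate and the probe ABSTRACT.
* §2 `conjSection` plumbing (`conj_mul_hom`), **`conj_comp_eq_of_normalised`** (the rigidity transport), `toRep_conj_comp_eq`.
* §3 **`probe_toRep_comp_eq_mul`** (the functional identity), `exists_probe_eq_iff` (ranges agree up to `Φ ↦ ω(P̃)⁻¹Φ` and the unit `c_q`).
HONEST LABEL.  Count-neutral helper; `HC_CM` is proved only modulo the 7 printed citations (2 remaining named inputs: hLiu418 = `stmt-HodgeConjecture-24832`,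
h413 = `stmt-HodgeConjecture-24833`) until rung 0 closes.  NOT here: any instance (`ψ_T`, `k_S`, `d_a`), the symplectic bookkeeping `π(Σ♯ g) = π(P̃)⁻¹π(Σ(ψ g))π(P̃)` ((nat-0)/(nat-1)),
the vanishing of `P_Δ`-trivial characters (★ `eq_one_of_forall_isSiegelDelta_eq_one'`).

## References
* [Kudla1994] S. Kudla, *Splitting metaplectic covers of dual reductive pairs*, Israel J. Math. 87 (1994), §3 Thm. 3.1.
* [GelbartRogawski1991] S. Gelbart, J. Rogawski, Invent. Math. 105 (1991), §3.1 Prop. 3.1.1 p. 455, Remark p. 457 L4–13.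
* [MoeglinVignerasWaldspurger1987] C. Mœglin, M.-F. Vignéras, J.-L. Waldspurger, LNM 1291 (1987), Chap. 2 II.1 (A)–(B).
* [HarrisKudlaSweet1996] M. Harris, S. Kudla, W. Sweet, J. AMS 9 (1996), §1 (1.11)–(1.16).
-/

set_option autoImplicit false
set_option linter.dupNamespace false -- the mandated namespace repeats `HodgeConjecture.HodgeConjecture`

universe u v u' v' w w'

open Literature.RepresentationTheory.HeisenbergGroup

namespace Summit.HodgeConjecture.HodgeConjecture.Cruxes.HLiu418.K2LiuKudlaRigidityTransport

variable {R : Type u} [CommRing R] [Invertible (2 : R)] {V : Type v} [AddCommGroup V] [Module R V] {B : V →ₗ[R] V →ₗ[R] R}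
variable {k : Type u'} [Field k] {S : Type v'} [AddCommGroup S] [Module k S]
variable (ρ : Representation k (Heisenberg B) S)

/-! ## §1 Rigidity with an abstract parabolic predicate and an abstract probe -/

/-- **KUDLA RIGIDITY, ABSTRACT FORM.**  Implementers unique up to scalars; `s, s' : G →* S̃p_ψ` with equal projections; a predicate `PΔ` on `G` on which every trivialising
character is trivial; a `k`-linear probe `ev` with a test vector `Φ₀`, `ev Φ₀ ≠ 0`; both sections normalised after conjugation by `m`: `ev(ω(m s(p) m⁻¹)Φ) = c(p)·ev Φ` with `c(p) ≠ 0`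
on `PΔ` ⇒ `s' = s` (★ `eq_of_parabolic_toRep_conj_eq` is the instance `G = U(J)(F_v)`, `PΔ = IsSiegelDelta`, `ev = ` evaluation at `0`, `Φ₀ = 𝟙_{𝒪^N}`).
[cite: Kudla1994, §3 Thm. 3.1] [cite: MoeglinVignerasWaldspurger1987, Chap. 2 II.1 (B)] -/
theorem eq_of_normalised_of_proj_eq (hU : ImplementerUniqueUpToScalar ρ) {G : Type w} [Group G] (s s' : G →* MpPsi ρ)
    (hss' : ∀ g, MpPsi.proj ρ (s' g) = MpPsi.proj ρ (s g)) (PΔ : G → Prop) (hκ : ∀ θ : G →* kˣ, (∀ p, PΔ p → θ p = 1) → θ = 1)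
    (ev : S →ₗ[k] k) (Φ₀ : S) (hΦ₀ : ev Φ₀ ≠ 0) (c : G → k) (hc : ∀ p, PΔ p → c p ≠ 0) (m : MpPsi ρ)
    (hs : ∀ p, PΔ p → ∀ Φ, ev (MpPsi.toRep ρ (m * s p * m⁻¹) Φ) = c p * ev Φ)
    (hs' : ∀ p, PΔ p → ∀ Φ, ev (MpPsi.toRep ρ (m * s' p * m⁻¹) Φ) = c p * ev Φ) : s' = s := by
  haveI : Nontrivial S := by
    refine ⟨⟨Φ₀, 0, fun h0 => hΦ₀ ?_⟩⟩
    rw [h0, map_zero]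
  obtain ⟨η, hη⟩ := MpPsi.exists_character_of_proj_eq ρ hU s s' hss'
  have hη1 : ∀ p, PΔ p → η p = 1 := by
    intro p hp
    have A := hs p hp Φ₀
    have A' := hs' p hp Φ₀
    rw [hη p, MpPsi.conj_ofScalar_mul, MpPsi.toRep_ofScalar_mul, map_smul, smul_eq_mul, A] at A'
    -- `A' : c p * (η p * ev Φ₀) = c p * ev Φ₀`
    have h2 : (η p : k) * ev Φ₀ = 1 * ev Φ₀ := by
      rw [one_mul]
      refine mul_left_cancel₀ (hc p hp) ?_
      rw [← A']
      ring
    exact Units.val_eq_one.1 (mul_right_cancel₀ hΦ₀ h2)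
  have hη' : η = 1 := hκ η hη1
  refine MonoidHom.ext fun g => ?_
  rw [hη g, hη', MonoidHom.one_apply, map_one, one_mul]

/-! ## §2 The rigidity transport along `(ψ, P̃)` -/

section Transport

variable {G' : Type w} [Group G'] {G'' : Type w'} [Group G'']

/-- `g ↦ P̃⁻¹ · Σ(ψ g) · P̃` is multiplicative. [folklore] -/
theorem conj_map_mul (Sg : G' →* MpPsi ρ) (ψ : G'' ≃* G') (P : MpPsi ρ) (g h : G'') :
    P⁻¹ * Sg (ψ (g * h)) * P = (P⁻¹ * Sg (ψ g) * P) * (P⁻¹ * Sg (ψ h) * P) := by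
  rw [map_mul, map_mul]
  simp only [mul_assoc, mul_inv_cancel_left]

/-- conjugating the conjugated section by the mover `m·P̃` is conjugating `Σ ∘ ψ` by `m`. [folklore] -/
theorem mover_conj_conj (Sg : G' →* MpPsi ρ) (ψ : G'' ≃* G') (P m : MpPsi ρ) (g : G'') :
    (m * P) * (P⁻¹ * Sg (ψ g) * P) * (m * P)⁻¹ = m * Sg (ψ g) * m⁻¹ := by
  simp only [mul_inv_rev, mul_assoc, mul_inv_cancel_left]

/-- **THE RIGIDITY TRANSPORT.**  `Σ : G′ →* S̃p_ψ` normalised on `P′_Δ` with scalar `c′` for the mover `m`; `ψ : G″ ≃* G′` with `P′_Δ(ψ g) ↔ P″_Δ(g)`; a section `Σ♯ : G″ →* S̃p_ψ` with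
`π(Σ♯ g) = π(P̃)⁻¹·π(Σ(ψ g))·π(P̃)` normalised on `P″_Δ` with scalar `c′ ∘ ψ` for the mover `m·P̃`; characters of `G″` trivial on `P″_Δ` trivial; implementers unique up to scalars; a probe
with a test vector ⇒ **`P̃⁻¹ · Σ(ψ g) · P̃ = Σ♯(g)`** for every `g`. [cite: Kudla1994, §3 Thm. 3.1] [cite: GelbartRogawski1991, §3.1 Remark p. 457 L4–13] -/
theorem conj_comp_eq_of_normalised (hU : ImplementerUniqueUpToScalar ρ) (Sg : G' →* MpPsi ρ) (ψ : G'' ≃* G') (P : MpPsi ρ) (Ss : G'' →* MpPsi ρ)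
    (hproj : ∀ g, MpPsi.proj ρ (Ss g) = (MpPsi.proj ρ P)⁻¹ * MpPsi.proj ρ (Sg (ψ g)) * MpPsi.proj ρ P)
    (PΔ' : G' → Prop) (PΔ'' : G'' → Prop) (hPΔ : ∀ g, PΔ'' g → PΔ' (ψ g))
    (hκ : ∀ θ : G'' →* kˣ, (∀ p, PΔ'' p → θ p = 1) → θ = 1)
    (ev : S →ₗ[k] k) (Φ₀ : S) (hΦ₀ : ev Φ₀ ≠ 0) (c' : G' → k) (hc : ∀ p, PΔ' p → c' p ≠ 0) (m : MpPsi ρ)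
    (hSg : ∀ p, PΔ' p → ∀ Φ, ev (MpPsi.toRep ρ (m * Sg p * m⁻¹) Φ) = c' p * ev Φ)
    (hSs : ∀ p, PΔ'' p → ∀ Φ, ev (MpPsi.toRep ρ ((m * P) * Ss p * (m * P)⁻¹) Φ) = c' (ψ p) * ev Φ) (g : G'') :
    P⁻¹ * Sg (ψ g) * P = Ss g := by
  let Sc : G'' →* MpPsi ρ := MonoidHom.mk' (fun g => P⁻¹ * Sg (ψ g) * P) (conj_map_mul ρ Sg ψ P)
  have hSc : ∀ g, Sc g = P⁻¹ * Sg (ψ g) * P := fun _ => rfl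
  have key : Ss = Sc := by
    refine eq_of_normalised_of_proj_eq ρ hU Sc Ss (fun g => ?_) PΔ'' hκ ev Φ₀ hΦ₀ (fun g => c' (ψ g)) (fun p hp => hc _ (hPΔ p hp)) (m * P)
      (fun p hp Φ => ?_) hSs
    · rw [hproj g, hSc, map_mul, map_mul, map_inv]
    · rw [hSc, mover_conj_conj]
      exact hSg (ψ p) (hPΔ p hp) Φ
  rw [← hSc, key]

/-- the operator form: `ω(Σ(ψ g)) = ω(P̃) ∘ ω(Σ♯ g) ∘ ω(P̃)⁻¹`. [cite: Kudla1994, §3 Thm. 3.1] -/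
theorem toRep_comp_eq_of_conj_eq (Sg : G' →* MpPsi ρ) (ψ : G'' ≃* G') (P : MpPsi ρ) (Ss : G'' →* MpPsi ρ)
    (hconj : ∀ g, P⁻¹ * Sg (ψ g) * P = Ss g) (g : G'') (Φ : S) :
    MpPsi.toRep ρ (Sg (ψ g)) Φ = MpPsi.toRep ρ P (MpPsi.toRep ρ (Ss g) (MpPsi.toRep ρ P⁻¹ Φ)) := by
  have h : Sg (ψ g) = P * Ss g * P⁻¹ := by
    rw [← hconj g]
    simp only [mul_assoc, mul_inv_cancel_left, mul_inv_cancel, mul_one]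
  rw [h, map_mul, map_mul, Module.End.mul_apply, Module.End.mul_apply]

end Transport

/-! ## §3 The Siegel–Weil functionals agree up to a unit -/

section Functionals

variable {G' : Type w} [Group G'] {G'' : Type w'} [Group G'']

/-- **THE FUNCTIONAL IDENTITY.**  With `P̃⁻¹ Σ(ψ g) P̃ = Σ♯(g)` and two «movers» `m₀′`, `m♯` whose discrepancy `q = m₀′ P̃ m♯⁻¹` scales the probe, `ev ∘ ω(q) = c_q · ev`:
**`ev(ω(m₀′·Σ(ψ g))Φ) = c_q · ev(ω(m♯·Σ♯ g)(ω(P̃)⁻¹Φ))`** — the local Siegel–Weil section `F′_Φ` read through `ψ` is `c_q · F♯_{ω(P̃)⁻¹Φ}`.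
[cite: Kudla1994, §3 Thm. 3.1] [cite: HarrisKudlaSweet1996, §1 (1.16)] -/
theorem probe_toRep_comp_eq_mul (Sg : G' →* MpPsi ρ) (ψ : G'' ≃* G') (P : MpPsi ρ) (Ss : G'' →* MpPsi ρ)
    (hconj : ∀ g, P⁻¹ * Sg (ψ g) * P = Ss g) (ev : S →ₗ[k] k) (m₀' ms : MpPsi ρ) {cq : k}
    (hq : ∀ Φ, ev (MpPsi.toRep ρ (m₀' * P * ms⁻¹) Φ) = cq * ev Φ) (g : G'') (Φ : S) :
    ev (MpPsi.toRep ρ (m₀' * Sg (ψ g)) Φ) = cq * ev (MpPsi.toRep ρ (ms * Ss g) (MpPsi.toRep ρ P⁻¹ Φ)) := by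
  have h : m₀' * Sg (ψ g) = (m₀' * P * ms⁻¹) * ((ms * Ss g) * P⁻¹) := by
    rw [← hconj g]
    simp only [mul_assoc, inv_mul_cancel_left, mul_inv_cancel_left, mul_inv_cancel, mul_one]
  rw [h, map_mul, Module.End.mul_apply, hq, map_mul, Module.End.mul_apply]

/-- **THE RANGES AGREE**: a function `f : G″ → k` is a Siegel–Weil section read through `ψ` iff it is (`c_q` times) a transported one — so the two local Siegel–Weil images, as
`k`-submodules of `G″ → k`, coincide (`c_q` a unit, `Φ ↦ ω(P̃)⁻¹Φ` bijective). [cite: Kudla1994, §3 Thm. 3.1] [cite: HarrisKudlaSweet1996, §1 (1.16)] -/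
theorem exists_probe_eq_iff (Sg : G' →* MpPsi ρ) (ψ : G'' ≃* G') (P : MpPsi ρ) (Ss : G'' →* MpPsi ρ)
    (hconj : ∀ g, P⁻¹ * Sg (ψ g) * P = Ss g) (ev : S →ₗ[k] k) (m₀' ms : MpPsi ρ) {cq : k}
    (hq : ∀ Φ, ev (MpPsi.toRep ρ (m₀' * P * ms⁻¹) Φ) = cq * ev Φ) (f : G'' → k) :
    (∃ Φ, (fun g => ev (MpPsi.toRep ρ (m₀' * Sg (ψ g)) Φ)) = f) ↔ ∃ Ψ, (fun g => cq * ev (MpPsi.toRep ρ (ms * Ss g) Ψ)) = f := by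
  constructor
  · rintro ⟨Φ, rfl⟩
    exact ⟨MpPsi.toRep ρ P⁻¹ Φ, funext fun g => (probe_toRep_comp_eq_mul ρ Sg ψ P Ss hconj ev m₀' ms hq g Φ).symm⟩
  · rintro ⟨Ψ, rfl⟩
    refine ⟨MpPsi.toRep ρ P Ψ, funext fun g => ?_⟩
    rw [probe_toRep_comp_eq_mul ρ Sg ψ P Ss hconj ev m₀' ms hq g]
    have hP : MpPsi.toRep ρ P⁻¹ (MpPsi.toRep ρ P Ψ) = Ψ := by
      rw [← Module.End.mul_apply, ← map_mul, inv_mul_cancel, map_one, Module.End.one_apply]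
    rw [hP]

end Functionals

end Summit.HodgeConjecture.HodgeConjecture.Cruxes.HLiu418.K2LiuKudlaRigidityTransport
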